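import Summits.BirchSwinnertonDyer.BirchSwinnertonDyer.Theses.PrintX10b
import Summits.BirchSwinnertonDyer.BirchSwinnertonDyer.Theorems.PrintX10bAssemblyPinnedTwins
import HarnessLib

/-!
# `AssemblyLightTwinsX10b` (stmt-BirchSwinnertonDyer-27276, route PrintX10b rev 33, rank 1) HOLDS:
# the Cha-free, J₃-free assembly of the X10b leaf from the LIGHT pinned twins — TURNKEY T-H′ landed

HONEST FRAMING (cell `run/shared/lean/pub/bsd-print-x9/`, D-0154 KEY row 10, seat `bsd-line-x10b-p1-w2`
gen 2 = «x10b-p1 successor»; lineage: crux stmt-BirchSwinnertonDyer-23055, then 26625 `AssemblyPinnedTwinsX10b`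
closed by this seat, p614012). This file proves the route decl `PrintX10b.AssemblyLightTwinsX10b` BY NAME and
OUTRIGHT (no hypothesis, no named fact, no `sorry`): it is an IMPLICATION between route items —
`HowardContainmentLightFrameX10bPinned → TwoSidedLinkAnyClassNumberX10bPinned → HeegnerPrintFactsX10b →
AnalyticMuZeroX10b → PrintFactsX10b → X10.BSDpOnClassX10b` — so closing it books NO mathematics beyond the
composition: the leaf `X10.BSDpOnClassX10b` stays conditional on the LIGHT A-side (stmt-27274; deciding crux
`HowardContainmentLightFrameX10bPinnedOfPrint`, beyond print in its μ-part at `3 ∣ h_K`), on B₃^pin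
(stmt-26622, print modulo the bundle door stmt-26624), on `AnalyticMuZeroX10b` and on the two print bundles.
«beyond-print theorem»: NO. BSD is not proved by any of this; no summit statement is proved by this seat.

PROOF: one application of this seat's route-text-free helper
`X10.bsdpOnClassX10b_of_pinnedTwinsLight_of_printFacts` (p617381, `Theorems/PrintX10bAssemblyPinnedTwins.lean`):
the LIGHT A-side at the frame (fed `hodd h3 hHN hHp hirrK … hc hrk hfinp`) + B₃^pin give the one-sided link U₃
on every X10b Heegner frame (`X10.upperLink_of_pinnedTwinsLight`), and the upper-link road
`X10.bsdpOnClassX10b_of_upperLink_of_printFacts` (p608951; NO J₃, NO Cha Rmk. 25) gives the leaf. The filed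
text of `HowardContainmentLightFrameX10bPinned` (rev 33) is letter for letter the helper's `hA3` binder
(= PrintX9 `HowardContainmentLightFramePinned` with `ClassX9 W p →` ↦ `ClassX10 W p → ¬ Surj W 3 → ¬ W.HasCM →`).

References: [JetchevSkinnerWan2017] Thm. 3.3.1, §7.4.1; [Castella2018] Thm. 2.3, §5 (eq:IMC+BDP);
[CastellaGrossiLeeSkinner2022] Thm. 4.1.1 (any class number, `E(K)[p] = 0`: the source of the LIGHT binders),
Thm. 5.1.3; [YanZhu2024MainConjNonCM] Thm. 5.9; route file `Theses/PrintX10b.lean` rev 33 (items 27274, 27276);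
`Theorems/PrintX10bAssemblyPinnedTwins.lean` (p617381); `Theorems/PrintX10bUpperLinkRoad.lean` (p608951).
-/

set_option autoImplicit false
set_option linter.dupNamespace false

noncomputable section

namespace Summit.BirchSwinnertonDyer.BirchSwinnertonDyer.Theorems.PrintX10bAssemblyLightTwinsX10b

open Summit.BirchSwinnertonDyer.BirchSwinnertonDyer.Theses.PrintX10b

/-- **`AssemblyLightTwinsX10b` holds** (stmt-BirchSwinnertonDyer-27276; TURNKEY T-H′ of PrintX10b rev 27–33):
the LIGHT pinned twins give U₃ on every X10b Heegner frame and the upper-link road gives the leaf — one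
application of `X10.bsdpOnClassX10b_of_pinnedTwinsLight_of_printFacts` (p617381).
[cite: JetchevSkinnerWan2017, Thm. 3.3.1 and §7.4.1 (arXiv:1512.06894 p. 30) (the road's rank-one descent)]
[cite: CastellaGrossiLeeSkinner2022, Thm. 4.1.1 (the LIGHT binders: any class number, `E(K)[p] = 0`)]
[cite: Cha2005, Rmk. 25 (p. 175) (NOT used — the point of the pinned road)] -/
theorem assemblyLightTwinsX10b_proof : AssemblyLightTwinsX10b := by
  unfold AssemblyLightTwinsX10b
  intro hA3 hB3 hHP hA hP
  exact Summit.BirchSwinnertonDyer.Rank1Residual.X10.bsdpOnClassX10b_of_pinnedTwinsLight_of_printFacts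
    hA3 hB3 hHP hA hP

end Summit.BirchSwinnertonDyer.BirchSwinnertonDyer.Theorems.PrintX10bAssemblyLightTwinsX10b

end
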